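import Summits.KontsevichZagierPeriods.KontsevichZagierPeriods.Theses.DefinableMoves
import Literature.NumberTheory.Transcendental.KZVolumeConjectureProofs

/-!
# `RealKZOfVolumes` (stmt-KontsevichZagierPeriods-14462) — the real volume form implies `RealKZ`

Route `DefinableMoves` of `KontsevichZagierPeriods`, support item `RealKZOfVolumes`:

  `RealVolumeConjecture → RealKZ`.

`RealVolumeConjecture` (crux #5 of the route) is Cresson–Viu-Sos's volume form of Kontsevich–Zagier's
Conjecture 1 with REAL intermediate data: two compact top-dimensional `ℚ`-semialgebraic bodies of one
dimension with integrand `1` and equal volume have real base changes equivalent in the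
real-coefficient calculus `KZ_ℝ = KZOver ℝ`. `RealKZ` (the route's target) says that two `ℚ`-rational
representations of equal value have `incl ([r] − [r'])` in the subgroup `Rel` of the free abelian
group on raw pairs `(σ, f)` generated by the four moves with real-semialgebraic data — written in
the route file as an inline `let`-prefix.

Proof (two steps).

1. *The inline calculus is `KZOver.Raw`.* The `let`-bound `Adm`, `o`, `Rel` of `RealKZ` are,
   after `ζ`-reduction, syntactically the bodies of `KZOver.Raw.Adm`, `KZOver.Raw.gen`,
   `KZOver.Raw.Rel` of `Literature/NumberTheory/Transcendental/KZCalculusOver.lean`, and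
   `incl [r] = KZOver.Raw.gen n r.domain r.integrand` on generators (`rfl`). Hence, by the tree's
   comparison lemma `KZOver.Raw.gen_sub_gen_mem_Rel_iff_kz`, the conclusion of `RealKZ` for
   `r`, `r'` is `KZOver.Equivalent (ofKZOver ℝ r) (ofKZOver ℝ r')`.
2. *Cresson–Viu-Sos over `ℚ`, then base change.* Verbatim the tree's
   `KZ.kzPeriodConjecture'_of_volumeConjectureCompact` [Cresson–Viu-Sos 2022, §1 p. 326], with
   Viu-Sos's semi-canonical reduction discharged in tree (`KZ.semiCanonicalReduction_holds`):
   `[r] ≡ [A] − [B]`, `[r'] ≡ [A'] − [B']` modulo `KZ.relations` with volume representations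
   (`exists_sub_volumeRep_mem_relations_of_semiCanonicalReduction`), all four raised to one
   dimension (`exists_volumeRep_equivalent_of_le`) and glued, `M₁ ≡ [A] + [B']`,
   `M₂ ≡ [A'] + [B]` (`exists_volumeRep_of_add_sub_of_mem_relations`); soundness of the moves
   gives `vol M₁ = vol M₂`, so `RealVolumeConjecture` yields `[M₁] ≡ [M₂]` in `KZ_ℝ`; the
   `ℚ`-relations are pushed into `KZOver.relations ℝ` along
   `KZOver.baseChange ℚ ℝ ∘ KZOver.equivKZ` (`equivKZ_mem_relations_iff`,
   `baseChange_mem_relations`) and the bookkeeping is done in `KZOver.FormalRep ℝ`.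

Sources: J. Cresson, J. Viu-Sos, *On the equality of periods of Kontsevich–Zagier*, JTNB 34 (2022),
§1 p. 326; J. Viu-Sos, *A semi-canonical reduction for periods of Kontsevich–Zagier*, IJNT 17 (2021),
Thm. 1.1; M. Kontsevich, D. Zagier, *Periods* (2001), §1.2. Deliberately NOT here: anything about
`RealVolumeConjecture` or `RealKZ` themselves (conjecture-strength; this file is the implication only).
-/

noncomputable section

open Literature.NumberTheory.Transcendental
open Summit.KontsevichZagierPeriods.KontsevichZagierPeriods.Theses.DefinableMoves

namespace Summit.KontsevichZagierPeriods.DefinableMoves.RealKZOfVolumes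

/-- **Cresson–Viu-Sos over `ℚ`, base-changed to `KZ_ℝ`.** Under `RealVolumeConjecture`, two KZ
integral representations (of any dimensions) with the same value have real base changes equivalent
in `KZOver ℝ`. Proof: the tree's `KZ.kzPeriodConjecture'_of_volumeConjectureCompact` verbatim —
`[r] ≡ [A] − [B]`, `[r'] ≡ [A'] − [B']` with volume representations by the discharged
semi-canonical reduction, raise to a common dimension, glue `M₁ ≡ [A] + [B']`, `M₂ ≡ [A'] + [B]`,
`vol M₁ = vol M₂` by soundness — except that the last step `[M₁] ≡ [M₂]` is supplied over `ℝ` by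
`RealVolumeConjecture`, the `ℚ`-relations being transported along
`KZOver.baseChange ℚ ℝ ∘ KZOver.equivKZ` (`KZOver.equivKZ_mem_relations_iff`,
`KZOver.baseChange_mem_relations`). [Cresson–Viu-Sos 2022, §1 p. 326; Viu-Sos 2021, Thm. 1.1] -/
theorem equivalent_ofKZOver_of_value_eq (hV : RealVolumeConjecture) {n m : ℕ}
    (r : KZ.IntegralRep n) (r' : KZ.IntegralRep m) (hv : r.value = r'.value) :
    KZOver.Equivalent (KZOver.IntegralRep.ofKZOver ℝ r) (KZOver.IntegralRep.ofKZOver ℝ r') := by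
  obtain ⟨D, A, B, ⟨hAc, hAi, hA1⟩, ⟨hBc, hBi, hB1⟩, hrAB⟩ :=
    KZ.IntegralRep.exists_sub_volumeRep_mem_relations_of_semiCanonicalReduction
      KZ.semiCanonicalReduction_holds r
  obtain ⟨D', A', B', ⟨hA'c, hA'i, hA'1⟩, ⟨hB'c, hB'i, hB'1⟩, hr'AB⟩ :=
    KZ.IntegralRep.exists_sub_volumeRep_mem_relations_of_semiCanonicalReduction
      KZ.semiCanonicalReduction_holds r'
  -- raise the four volume representations to the common dimension `max D D'`
  obtain ⟨A₁, hA₁c, hA₁i, hA₁1, hAA₁⟩ :=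
    A.exists_volumeRep_equivalent_of_le hAc hAi hA1 (le_max_left D D')
  obtain ⟨B₁, hB₁c, hB₁i, hB₁1, hBB₁⟩ :=
    B.exists_volumeRep_equivalent_of_le hBc hBi hB1 (le_max_left D D')
  obtain ⟨A₁', hA₁'c, hA₁'i, hA₁'1, hAA₁'⟩ :=
    A'.exists_volumeRep_equivalent_of_le hA'c hA'i hA'1 (le_max_right D D')
  obtain ⟨B₁', hB₁'c, hB₁'i, hB₁'1, hBB₁'⟩ :=
    B'.exists_volumeRep_equivalent_of_le hB'c hB'i hB'1 (le_max_right D D')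
  -- glue `A₁ ⊔ B₁'` and `A₁' ⊔ B₁`
  obtain ⟨M₁, hM₁c, hM₁i, hM₁1, hM₁⟩ :=
    A₁.exists_volumeRep_of_add_sub_of_mem_relations B₁' hA₁c hA₁i hA₁1 hB₁'c hB₁'1
  obtain ⟨M₂, hM₂c, hM₂i, hM₂1, hM₂⟩ :=
    A₁'.exists_volumeRep_of_add_sub_of_mem_relations B₁ hA₁'c hA₁'i hA₁'1 hB₁c hB₁1
  -- the two glued sets have the same volume (soundness of the moves)
  have hvol : M₁.value = M₂.value := by
    have e₁ := KZ.eval_eq_zero_of_mem_relations hrAB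
    have e₂ := KZ.eval_eq_zero_of_mem_relations hr'AB
    have e₃ := KZ.eval_eq_zero_of_mem_relations hM₁
    have e₄ := KZ.eval_eq_zero_of_mem_relations hM₂
    simp only [map_sub, map_add, KZ.eval_of] at e₁ e₂ e₃ e₄
    have f₁ := KZ.Equivalent.value_eq_holds hAA₁
    have f₂ := KZ.Equivalent.value_eq_holds hBB₁
    have f₃ := KZ.Equivalent.value_eq_holds hAA₁'
    have f₄ := KZ.Equivalent.value_eq_holds hBB₁'
    linarith
  -- the real volume conjecture, over `ℝ`
  have hM : KZOver.of (KZOver.IntegralRep.ofKZOver ℝ M₁) -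
      KZOver.of (KZOver.IntegralRep.ofKZOver ℝ M₂) ∈ KZOver.relations ℝ :=
    hV M₁ M₂ hM₁c hM₁i hM₂c hM₂i hM₁1 hM₂1 hvol
  -- bookkeeping over `ℚ`
  have hX : KZ.of r - KZ.of r' - (KZ.of M₁ - KZ.of M₂) ∈ KZ.relations := by
    have : KZ.of r - KZ.of r' - (KZ.of M₁ - KZ.of M₂) =
        (KZ.of r - (KZ.of A - KZ.of B)) - (KZ.of r' - (KZ.of A' - KZ.of B'))
        + (KZ.of A - KZ.of A₁) - (KZ.of B - KZ.of B₁) - (KZ.of A' - KZ.of A₁')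
        + (KZ.of B' - KZ.of B₁')
        + (KZ.of A₁ + KZ.of B₁' - KZ.of M₁) - (KZ.of A₁' + KZ.of B₁ - KZ.of M₂) := by
      abel
    rw [this]
    exact KZ.relations.sub_mem (KZ.relations.add_mem (KZ.relations.add_mem
      (KZ.relations.sub_mem (KZ.relations.sub_mem (KZ.relations.add_mem
        (KZ.relations.sub_mem hrAB hr'AB) hAA₁) hBB₁) hAA₁') hBB₁') hM₁) hM₂
  -- transport to `ℝ` along `baseChange ℚ ℝ ∘ equivKZ` (`[s] ↦ [ofKZOver ℝ s]` on generators)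
  have hX' : KZOver.of (KZOver.IntegralRep.ofKZOver ℝ r) -
      KZOver.of (KZOver.IntegralRep.ofKZOver ℝ r') -
      (KZOver.of (KZOver.IntegralRep.ofKZOver ℝ M₁) -
        KZOver.of (KZOver.IntegralRep.ofKZOver ℝ M₂)) ∈ KZOver.relations ℝ := by
    simpa only [map_sub, KZOver.equivKZ_of, KZOver.baseChange_of] using
      KZOver.baseChange_mem_relations ℝ ((KZOver.equivKZ_mem_relations_iff _).mpr hX)
  -- add the real move `[M₁] ≡ [M₂]`
  rw [KZOver.Equivalent, ← sub_add_cancel (KZOver.of (KZOver.IntegralRep.ofKZOver ℝ r) -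
    KZOver.of (KZOver.IntegralRep.ofKZOver ℝ r')) (KZOver.of (KZOver.IntegralRep.ofKZOver ℝ M₁) -
      KZOver.of (KZOver.IntegralRep.ofKZOver ℝ M₂))]
  exact (KZOver.relations ℝ).add_mem hX' hM

/-- **Settles stmt-KontsevichZagierPeriods-14462** (`RealKZOfVolumes`, route DefinableMoves):
`RealVolumeConjecture → RealKZ`. After unfolding, the inline `let`-calculus of `RealKZ` is
definitionally `KZOver.Raw.Rel` and `incl ([r] − [r']) = Raw.gen r − Raw.gen r'`, so by the
comparison lemma `KZOver.Raw.gen_sub_gen_mem_Rel_iff_kz` the goal is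
`KZOver.Equivalent (ofKZOver ℝ r) (ofKZOver ℝ r')`, which is
`equivalent_ofKZOver_of_value_eq`; the rationality hypotheses on `r`, `r'` are not used.
[Cresson–Viu-Sos 2022, §1 p. 326; Kontsevich–Zagier 2001, §1.2] -/
theorem realKZOfVolumes_proof : RealKZOfVolumes := by
  unfold RealKZOfVolumes
  intro hV
  unfold RealKZ
  intro Adm o Rel incl n m r r' _ _ hv
  rw [map_sub]
  change KZOver.Raw.gen n r.domain r.integrand - KZOver.Raw.gen m r'.domain r'.integrand ∈
    KZOver.Raw.Rel
  rw [KZOver.Raw.gen_sub_gen_mem_Rel_iff_kz]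
  exact equivalent_ofKZOver_of_value_eq hV r r' hv

end Summit.KontsevichZagierPeriods.DefinableMoves.RealKZOfVolumes

end
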